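import Summits.QuantumFields.YangMills.Theorems.BalabanUVNodesN15KingModelTorusPlaneWaves
import Literature.MathematicalPhysics.QuantumFieldTheory.Balaban1983to89.Beta.WoodburyFibre
import HarnessLib

/-!
# BalabanUVNodes ∕ N15 — THE KING-MODEL RUNG (PART Ϯ-e): KING's COVARIANCE AT COINCIDING POINTS IS `O(η²)` IN FOUR DIMENSIONS, UNIFORMLY IN THE VOLUME —
# `c·(lapF)⁻¹(x,x) ≤ 5∕4 + c∕(m²K₀⁴)` on the cubic torus `(ℤ∕K₀)⁴` for every hopping `c > 0` and mass `m² > 0`; at King's scaling (`c = L²`, fine torus `(ℤ∕LM₀)⁴`):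
# `L²·G(x,x) ≤ 5∕4 + 1∕(m²L²M₀⁴)` — the constant of PART Ϯ's VOLUME LAW is η-UNIFORM AND VOLUME-UNIFORM (transience of the four-dimensional walk: Jordan's inequality + the tree's dyadic shells)
# (Track A, DAG node N15 = NE2; FAN-OUT v1.1 §N15 s3 «KING-MODEL RUNG … + what the curved case adds»; count-neutral)

HONEST FRAMING.  Count-neutral (cell `pub-ymgap`, seat `pub-ymgap-dag-n15-e` g54; `--supports stmt-QuantumFields-27247 --as helper` = K3ᴬ, KEY MAP v3).  King's `A = 0` fine covariance
`(c(−Δ) + m²)⁻¹` on the CUBIC four-torus `Π_μℤ∕K₀` (the tree's `cM K₀ : Fin 4 → ℕ`), in King's own plane waves (Ε-e `lapF_inv_diag_eq`: `G(x,x) = |T|⁻¹Σ_q lapSym(q)⁻¹`).  Exact finite sums and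
two elementary inequalities; `d + 1 = 4` ONLY (the dyadic-shell engine of `Beta.LargeLWindow` is four-dimensional; in `d+1 ≤ 2` the statement is false — `G(0,0)` grows like `ln K₀` resp. `K₀`);
equal periods only.  NOT Bałaban's (3.42); NOT a node discharge (N15 of record untouched); nothing continuum ∕ ℝ⁴ ∕ OS ∕ Clay.

THE POINT.  PART Ϯ-b∕c∕d proved the VOLUME LAW for King's Gaussian normalisations with the constant `c·G(0,0)`, `G(0,0) = (lapF)⁻¹(0,0)`; the Loewner-floor bound `G(0,0) ≤ 1∕m²` (Ε-e) makes it
`O(c∕m²) = O(L²∕m²)` at King's scaling `c = L² = η⁻²` ((2.13) p.653, (4.4) p.670) — useless as `η → 0`.  THIS FILE: in four dimensions `c·G(0,0)` is bounded by an ABSOLUTE constant plus the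
zero-mode term `c∕(m²|T|)`, uniformly in the side `K₀` — so at `c = L²`, `|T| = (LM₀)⁴` the volume-law constant is `≤ 8|n|²(5∕4 + (m²L²M₀⁴)⁻¹) + a|n|∕m²`, uniform in `η = L⁻¹` and in `M₀`.
THE MECHANISM.  (i) ★ `lapSym_ge_supNorm_sq` — JORDAN: `2 − 2cos s = 4sin²(s∕2) ≥ (4∕π²)s²` on `|s| ≤ π` (tree `King1986.fdSymbol_ge_jordan`) at the reduced momentum `s = 2πv_ν∕K₀` of the
coordinate `ν` carrying the sup norm of the centred representative `v = vOf q` gives `lapSym(q) ≥ m² + 16c·‖v‖_∞²∕K₀²`; (ii) ★★ `sum_inv_lapSym_le_shell` — the tree's four-dimensional shell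
engine `Σ_{0<‖w‖_∞≤M}‖w‖_∞⁻² ≤ 80M²` (`Beta.LargeLWindow.Split.sum_inv_sq_window_le`) over the injective image `vOf` (`Beta.WoodburyFibre.vOf_injective`∕`vOf_mem_annulus`, `M = K₀∕2`):
`Σ_{q≠0} lapSym(q)⁻¹ ≤ (K₀²∕16c)·80·(K₀∕2)² = (5∕4)K₀⁴∕c`; (iii) the zero mode `lapSym(0)⁻¹ = 1∕m²` and `|T| = K₀⁴` ⟹ ★★★ **`mul_lapF_inv_diag_le_four`**; (iv) `fine L (cM M₀) = cM (LM₀)`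
definitionally ⟹ ★★★★ **`king_green_diag_eta_uniform`** at King's scaling, and ★★★ `mul_lapF_inv_entry_le_four` for every entry (Ε-e `abs_lapF_inv_le_diag`).

PRIOR TREE ART (by name, not restated): Ε-e `TorusPlaneWaves` (`lapF_inv_diag_eq`, `abs_lapF_inv_le_diag`), `King1986.EffectiveLaplacianSymbol` (`lapSym`), `King1986.EffectiveLaplacianRate`
(`fdSymbol`, `fdSymbol_ge_jordan`), `B5Prop11Plancherel` (`sOf`, `abs_sOf_le`), `Beta.WoodburyFibre` (`cM`, `vOf`, `vOf_injective`, `vOf_mem_annulus`, `lapSym_zero`, `lapSym_nonneg`),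
`Beta.DyadicShell` (`Pt`, `supNorm`, `mem_annulus_iff`, `exists_eq_supNorm`), `Beta.LargeLWindow.Split.sum_inv_sq_window_le`, Mathlib `Real.sin_sq_eq_half_sub`.
Dedup (rg at filing): basename 0 files; `lapSym_ge_supNorm_sq|sum_inv_lapSym_le_shell|mul_lapF_inv_diag_le_four|king_green_diag_eta_uniform|mul_lapF_inv_entry_le_four` 0 tree files.
Locators: [King1986] (2.13) p.653 (`c = L²` scaling of the fine covariance), (4.4) p.670 (the symbol), (4.35) p.674 (plane-wave sums); [Balaban1984PropagatorsI] (1.29) p.23 (finite Fourier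
inversion on the torus).  The estimate itself (bounded lattice Green's function at the origin in `d ≥ 3`) is classical [folklore]; the proof here is first-principles on the finite torus.  0 `sorry`, 0 `def`.
-/

noncomputable section

open scoped BigOperators
open Finset Real

namespace Summit.QuantumFields.YangMills.BalabanUVNodes.N15KingModelRung.Analytic

open Literature.Probability.LatticeModels (annulus)
open Literature.MathematicalPhysics.QuantumFieldTheory.Balaban1983to89.B5Prop11Plancherel (Tor fine sOf abs_sOf_le)
open Literature.MathematicalPhysics.QuantumFieldTheory.King1986 (fdSymbol fdSymbol_ge_jordan)
open Literature.MathematicalPhysics.QuantumFieldTheory.King1986.Torus (lapF lapSym)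
open Literature.MathematicalPhysics.QuantumFieldTheory.Balaban1983to89.Beta.DyadicShell (Pt supNorm mem_annulus_iff exists_eq_supNorm)
open Literature.MathematicalPhysics.QuantumFieldTheory.Balaban1983to89.Beta.WoodburyFibre (cM vOf vOf_injective vOf_mem_annulus lapSym_zero lapSym_nonneg)
open Literature.MathematicalPhysics.QuantumFieldTheory.Balaban1983to89.Beta.LargeLWindow (Split.sum_inv_sq_window_le)
open Summit.QuantumFields.YangMills.BalabanUVNodes.N15KingModelRung.TorusSpectral (lapF_inv_diag_eq abs_lapF_inv_le_diag)

variable (K₀ : ℕ) [NeZero K₀]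

/-! ## §1 Jordan: the symbol dominates the squared sup-norm of the centred momentum -/

/-- `2 − 2cos s = 4sin²(s∕2)` = the tree's `fdSymbol 1 s`. [cite: King1986, (4.4) p.670] -/
theorem two_sub_two_cos_eq_fdSymbol (s : ℝ) : 2 - 2 * Real.cos s = fdSymbol 1 s := by
  unfold fdSymbol
  have h : Real.sin (s / 2) ^ 2 = 1 / 2 - Real.cos s / 2 := by
    rw [Real.sin_sq_eq_half_sub, mul_div_cancel₀ s two_ne_zero]
  rw [one_pow, one_mul, h]
  ring

/-- ★ **JORDAN ON THE CUBIC FOUR-TORUS**: `m² + 16c·‖vOf q‖_∞²∕K₀² ≤ lapSym(q)` for `c, m² ≥ 0` — `2 − 2cos(2πv_ν∕K₀) ≥ (4∕π²)(2πv_ν∕K₀)² = 16v_ν²∕K₀²` at the coordinate `ν` carrying the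
sup norm, the other three terms being `≥ 0` (any real `m²`). [cite: King1986, (4.4) p.670, proof of Lemma 4.1 p.671] -/
theorem lapSym_ge_supNorm_sq {c : ℝ} (hc : 0 ≤ c) (m2 : ℝ) (q : Tor (cM K₀)) :
    m2 + 16 * c * (supNorm (vOf K₀ q) : ℝ) ^ 2 / (K₀ : ℝ) ^ 2 ≤ lapSym (cM K₀) c m2 q := by
  have hK : (0 : ℝ) < K₀ := by exact_mod_cast Nat.pos_of_ne_zero (NeZero.ne K₀)
  obtain ⟨ν, hν⟩ := exists_eq_supNorm (vOf K₀ q)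
  -- the `ν`-th term alone
  have hterm : 16 * (supNorm (vOf K₀ q) : ℝ) ^ 2 / (K₀ : ℝ) ^ 2 ≤ 2 - 2 * Real.cos (sOf (cM K₀) q ν) := by
    rw [two_sub_two_cos_eq_fdSymbol]
    have hj := fdSymbol_ge_jordan (η := 1) one_ne_zero (x := sOf (cM K₀) q ν) (by rw [one_mul]; exact abs_sOf_le (cM K₀) q ν)
    have e : ((supNorm (vOf K₀ q) : ℕ) : ℝ) = |(((q ν).valMinAbs : ℤ) : ℝ)| := by
      rw [← hν, Nat.cast_natAbs (α := ℝ), Int.cast_abs]; rfl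
    have hs : sOf (cM K₀) q ν ^ 2 = 4 * π ^ 2 * (supNorm (vOf K₀ q) : ℝ) ^ 2 / (K₀ : ℝ) ^ 2 := by
      unfold sOf
      rw [e, sq_abs]
      simp only [cM]
      field_simp
      ring
    calc 16 * (supNorm (vOf K₀ q) : ℝ) ^ 2 / (K₀ : ℝ) ^ 2 = 4 / π ^ 2 * sOf (cM K₀) q ν ^ 2 := by rw [hs]; field_simp; ring
      _ ≤ fdSymbol 1 (sOf (cM K₀) q ν) := hj
  -- the other terms are nonnegative
  have hsum : (2 - 2 * Real.cos (sOf (cM K₀) q ν)) ≤ ∑ μ : Fin 4, (2 - 2 * Real.cos (sOf (cM K₀) q μ)) :=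
    Finset.single_le_sum (f := fun μ => 2 - 2 * Real.cos (sOf (cM K₀) q μ)) (fun μ _ => by linarith [Real.cos_le_one (sOf (cM K₀) q μ)]) (Finset.mem_univ ν)
  unfold lapSym
  have : 16 * c * (supNorm (vOf K₀ q) : ℝ) ^ 2 / (K₀ : ℝ) ^ 2 = c * (16 * (supNorm (vOf K₀ q) : ℝ) ^ 2 / (K₀ : ℝ) ^ 2) := by ring
  rw [this]
  have h2 := mul_le_mul_of_nonneg_left (hterm.trans hsum) hc
  linarith

/-- Consequence used in the sum: for `q ≠ 0` and `c > 0`, `lapSym(q)⁻¹ ≤ (K₀²∕(16c))·‖vOf q‖_∞⁻²`. [cite: King1986, (4.4) p.670] -/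
theorem inv_lapSym_le_of_ne_zero {c m2 : ℝ} (hc : 0 < c) (hm2 : 0 ≤ m2) {q : Tor (cM K₀)} (hq : q ≠ 0) :
    (lapSym (cM K₀) c m2 q)⁻¹ ≤ (K₀ : ℝ) ^ 2 / (16 * c) * (1 / (supNorm (vOf K₀ q) : ℝ) ^ 2) := by
  have hK : (0 : ℝ) < K₀ := by exact_mod_cast Nat.pos_of_ne_zero (NeZero.ne K₀)
  have hs : 0 < supNorm (vOf K₀ q) := ((mem_annulus_iff).mp (vOf_mem_annulus K₀ hq)).1
  have hsR : (0 : ℝ) < supNorm (vOf K₀ q) := by exact_mod_cast hs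
  have hlow := lapSym_ge_supNorm_sq K₀ hc.le m2 q
  have hpos : (0 : ℝ) < 16 * c * (supNorm (vOf K₀ q) : ℝ) ^ 2 / (K₀ : ℝ) ^ 2 := by positivity
  calc (lapSym (cM K₀) c m2 q)⁻¹ ≤ (16 * c * (supNorm (vOf K₀ q) : ℝ) ^ 2 / (K₀ : ℝ) ^ 2)⁻¹ :=
        inv_anti₀ hpos (le_trans (le_add_of_nonneg_left hm2) hlow)
    _ = (K₀ : ℝ) ^ 2 / (16 * c) * (1 / (supNorm (vOf K₀ q) : ℝ) ^ 2) := by field_simp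

/-! ## §2 The shell sum: `Σ_{q≠0} lapSym(q)⁻¹ ≤ (5∕4)·K₀⁴∕c` -/

/-- ★★ **THE FOUR-DIMENSIONAL SHELL SUM**: `Σ_{q ≠ 0} lapSym(q)⁻¹ ≤ (5∕4)·K₀⁴∕c` (`c > 0`, `m² ≥ 0`) — the tree's engine `Σ_{0<‖w‖_∞≤M}‖w‖_∞⁻² ≤ 80M²` at `M = K₀∕2` over the injective centred
representatives. [cite: King1986, (4.4) p.670, (4.35) p.674] -/
theorem sum_inv_lapSym_le_shell {c m2 : ℝ} (hc : 0 < c) (hm2 : 0 ≤ m2) :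
    ∑ q ∈ (Finset.univ : Finset (Tor (cM K₀))).erase 0, (lapSym (cM K₀) c m2 q)⁻¹ ≤ (5 / 4) * (K₀ : ℝ) ^ 4 / c := by
  have hK : (0 : ℝ) < K₀ := by exact_mod_cast Nat.pos_of_ne_zero (NeZero.ne K₀)
  set g : Pt → ℝ := fun w => 1 / (supNorm w : ℝ) ^ 2 with hg
  have hg0 : ∀ w, 0 ≤ g w := fun w => by positivity
  have hterm : ∀ q ∈ (Finset.univ : Finset (Tor (cM K₀))).erase 0, (lapSym (cM K₀) c m2 q)⁻¹ ≤ (K₀ : ℝ) ^ 2 / (16 * c) * g (vOf K₀ q) :=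
    fun q hq => inv_lapSym_le_of_ne_zero K₀ hc hm2 (Finset.ne_of_mem_erase hq)
  have hinj : Set.InjOn (vOf K₀) ↑((Finset.univ : Finset (Tor (cM K₀))).erase 0) := fun q _ q' _ h => vOf_injective K₀ h
  have hsub : ((Finset.univ : Finset (Tor (cM K₀))).erase 0).image (vOf K₀) ⊆ annulus 4 0 (K₀ / 2) := by
    intro w hw
    obtain ⟨q, hq, rfl⟩ := Finset.mem_image.mp hw
    exact vOf_mem_annulus K₀ (Finset.ne_of_mem_erase hq)
  have hhalf : ((K₀ / 2 : ℕ) : ℝ) ≤ (K₀ : ℝ) / 2 := Nat.cast_div_le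
  calc ∑ q ∈ (Finset.univ : Finset (Tor (cM K₀))).erase 0, (lapSym (cM K₀) c m2 q)⁻¹
      ≤ ∑ q ∈ (Finset.univ : Finset (Tor (cM K₀))).erase 0, (K₀ : ℝ) ^ 2 / (16 * c) * g (vOf K₀ q) := Finset.sum_le_sum hterm
    _ = (K₀ : ℝ) ^ 2 / (16 * c) * ∑ w ∈ ((Finset.univ : Finset (Tor (cM K₀))).erase 0).image (vOf K₀), g w := by
        rw [Finset.mul_sum, Finset.sum_image hinj]
    _ ≤ (K₀ : ℝ) ^ 2 / (16 * c) * ∑ w ∈ annulus 4 0 (K₀ / 2), g w :=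
        mul_le_mul_of_nonneg_left (Finset.sum_le_sum_of_subset_of_nonneg hsub fun w _ _ => hg0 w) (by positivity)
    _ ≤ (K₀ : ℝ) ^ 2 / (16 * c) * (80 * ((K₀ / 2 : ℕ) : ℝ) ^ 2) := by
        gcongr
        exact Split.sum_inv_sq_window_le (K₀ / 2)
    _ ≤ (K₀ : ℝ) ^ 2 / (16 * c) * (80 * ((K₀ : ℝ) / 2) ^ 2) := by gcongr
    _ = (5 / 4) * (K₀ : ℝ) ^ 4 / c := by field_simp; ring

/-- `|Π_{μ<4}ℤ∕K₀| = K₀⁴`. [folklore] -/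
theorem card_tor_cM : (Fintype.card (Tor (cM K₀)) : ℝ) = (K₀ : ℝ) ^ 4 := by
  have h : Fintype.card (Tor (cM K₀)) = K₀ ^ 4 := by
    simp [Tor, cM, Fintype.card_pi, ZMod.card, Finset.prod_const]
  rw [h]; push_cast; ring

/-- ★★ **THE FULL PLANE-WAVE SUM**: `Σ_q lapSym(q)⁻¹ ≤ 1∕m² + (5∕4)K₀⁴∕c` (the zero mode `lapSym(0) = m²` plus the shell sum). [cite: King1986, (4.4) p.670, (4.35) p.674] -/
theorem sum_inv_lapSym_le {c m2 : ℝ} (hc : 0 < c) (hm : 0 < m2) :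
    ∑ q : Tor (cM K₀), (lapSym (cM K₀) c m2 q)⁻¹ ≤ m2⁻¹ + (5 / 4) * (K₀ : ℝ) ^ 4 / c := by
  rw [← Finset.add_sum_erase _ _ (Finset.mem_univ (0 : Tor (cM K₀))), lapSym_zero]
  exact add_le_add le_rfl (sum_inv_lapSym_le_shell K₀ hc hm.le)

/-! ## §3 King's covariance at coinciding points on the cubic four-torus -/

/-- ★★★ **`c·G(x,x) ≤ 5∕4 + c∕(m²K₀⁴)` ON THE CUBIC FOUR-TORUS** (`G = (c(−Δ)+m²)⁻¹`, `c > 0`, `m² > 0`, every side `K₀ ≥ 1`): King's `A = 0` covariance at coinciding points in units of the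
hopping is bounded by an ABSOLUTE constant plus the zero-mode share — uniformly in the volume (transience of the four-dimensional walk). [cite: King1986, (2.13) p.653, (4.4) p.670, (4.35) p.674;
Balaban1984PropagatorsI, (1.29) p.23] -/
theorem mul_lapF_inv_diag_le_four {c m2 : ℝ} (hc : 0 < c) (hm : 0 < m2) (x : Tor (cM K₀)) :
    c * (lapF (cM K₀) c m2)⁻¹ x x ≤ 5 / 4 + c / (m2 * (K₀ : ℝ) ^ 4) := by
  have hK : (0 : ℝ) < K₀ := by exact_mod_cast Nat.pos_of_ne_zero (NeZero.ne K₀)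
  rw [lapF_inv_diag_eq (cM K₀) hc.le hm x, card_tor_cM]
  have h := sum_inv_lapSym_le K₀ hc hm
  have hK4 : (0 : ℝ) < (K₀ : ℝ) ^ 4 := by positivity
  calc c * (((K₀ : ℝ) ^ 4)⁻¹ * ∑ q : Tor (cM K₀), (lapSym (cM K₀) c m2 q)⁻¹)
      ≤ c * (((K₀ : ℝ) ^ 4)⁻¹ * (m2⁻¹ + (5 / 4) * (K₀ : ℝ) ^ 4 / c)) :=
        mul_le_mul_of_nonneg_left (mul_le_mul_of_nonneg_left h (by positivity)) hc.le
    _ = 5 / 4 + c / (m2 * (K₀ : ℝ) ^ 4) := by field_simp; ring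

/-- ★★★ … and for EVERY entry: `c·|G(x,y)| ≤ 5∕4 + c∕(m²K₀⁴)` (the diagonal dominates, Ε-e `abs_lapF_inv_le_diag`). [cite: King1986, (4.4) p.670, (4.35) p.674] -/
theorem mul_lapF_inv_entry_le_four {c m2 : ℝ} (hc : 0 < c) (hm : 0 < m2) (x y : Tor (cM K₀)) :
    c * |(lapF (cM K₀) c m2)⁻¹ x y| ≤ 5 / 4 + c / (m2 * (K₀ : ℝ) ^ 4) :=
  (mul_le_mul_of_nonneg_left (abs_lapF_inv_le_diag (cM K₀) hc.le hm x y) hc.le).trans (mul_lapF_inv_diag_le_four K₀ hc hm x)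

/-! ## §4 King's scaling: `c = L²` on the fine torus `(ℤ∕LM₀)⁴` — the volume-law constant is η-uniform -/

section KingScaling

variable (L M₀ : ℕ) [NeZero L] [NeZero M₀]

/-- ★★★★ **KING's COVARIANCE AT COINCIDING POINTS IS `O(η²)`, UNIFORMLY IN THE VOLUME**: on the fine four-torus `(ℤ∕LM₀)⁴` with King's scaling `c = L² = η⁻²` ((2.13) p.653),
`L²·G(x,x) ≤ 5∕4 + 1∕(m²L²M₀⁴)` for every `L ≥ 1`, every box side `M₀ ≥ 1`, every `m² > 0` — hence PART Ϯ-d's volume-law constant `8|n|²·c·G(0,0) + a|n|∕m²` is bounded by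
`8|n|²(5∕4 + (m²L²M₀⁴)⁻¹) + a|n|∕m²`, uniformly in the spacing `η = L⁻¹` and in the volume. [cite: King1986, (2.13) p.653, (4.4) p.670, (4.35) p.674; Balaban1984PropagatorsI, (1.29) p.23] -/
theorem king_green_diag_eta_uniform {m2 : ℝ} (hm : 0 < m2) (x : Tor (fine L (cM M₀))) :
    (L : ℝ) ^ 2 * (lapF (fine L (cM M₀)) ((L : ℝ) ^ 2) m2)⁻¹ x x ≤ 5 / 4 + 1 / (m2 * (L : ℝ) ^ 2 * (M₀ : ℝ) ^ 4) := by
  have hL : (0 : ℝ) < L := by exact_mod_cast Nat.pos_of_ne_zero (NeZero.ne L)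
  have hc : (0 : ℝ) < (L : ℝ) ^ 2 := by positivity
  haveI : NeZero (L * M₀) := ⟨Nat.mul_ne_zero (NeZero.ne L) (NeZero.ne M₀)⟩
  have h := mul_lapF_inv_diag_le_four (L * M₀) hc hm x
  have e : (L : ℝ) ^ 2 / (m2 * ((L * M₀ : ℕ) : ℝ) ^ 4) = 1 / (m2 * (L : ℝ) ^ 2 * (M₀ : ℝ) ^ 4) := by
    push_cast
    field_simp
  rw [e] at h
  exact h

/-- ★★★ The same for every entry: `L²·|G(x,y)| ≤ 5∕4 + 1∕(m²L²M₀⁴)`. [cite: King1986, (4.4) p.670, (4.35) p.674] -/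
theorem king_green_entry_eta_uniform {m2 : ℝ} (hm : 0 < m2) (x y : Tor (fine L (cM M₀))) :
    (L : ℝ) ^ 2 * |(lapF (fine L (cM M₀)) ((L : ℝ) ^ 2) m2)⁻¹ x y| ≤ 5 / 4 + 1 / (m2 * (L : ℝ) ^ 2 * (M₀ : ℝ) ^ 4) := by
  have hL : (0 : ℝ) < L := by exact_mod_cast Nat.pos_of_ne_zero (NeZero.ne L)
  exact (mul_le_mul_of_nonneg_left (abs_lapF_inv_le_diag (fine L (cM M₀)) (by positivity) hm x y) (by positivity)).trans
    (king_green_diag_eta_uniform L M₀ hm x)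

/-- ★★ THE η-UNIFORM CEILING WITHOUT THE VOLUME: `L²·G(x,x) ≤ 5∕4 + 1∕m²` (`L, M₀ ≥ 1`). [cite: King1986, (2.13) p.653, (4.4) p.670] -/
theorem king_green_diag_eta_uniform' {m2 : ℝ} (hm : 0 < m2) (x : Tor (fine L (cM M₀))) :
    (L : ℝ) ^ 2 * (lapF (fine L (cM M₀)) ((L : ℝ) ^ 2) m2)⁻¹ x x ≤ 5 / 4 + m2⁻¹ := by
  have hL1 : (1 : ℝ) ≤ L := by exact_mod_cast Nat.one_le_iff_ne_zero.mpr (NeZero.ne L)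
  have hM1 : (1 : ℝ) ≤ M₀ := by exact_mod_cast Nat.one_le_iff_ne_zero.mpr (NeZero.ne M₀)
  refine (king_green_diag_eta_uniform L M₀ hm x).trans (add_le_add le_rfl ?_)
  rw [one_div]
  apply inv_anti₀ hm
  have h1 : (1 : ℝ) ≤ (L : ℝ) ^ 2 * (M₀ : ℝ) ^ 4 := one_le_mul_of_one_le_of_one_le (one_le_pow₀ hL1) (one_le_pow₀ hM1)
  nlinarith

end KingScaling

end Summit.QuantumFields.YangMills.BalabanUVNodes.N15KingModelRung.Analytic

end
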